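import Literature.MathematicalPhysics.QuantumFieldTheory.ConformalBootstrap3D.CasimirRecursionPivots
import Mathlib.Algebra.Order.BigOperators.Group.Finset
import Mathlib.Tactic.FieldSimp
import Mathlib.Tactic.Linarith
import Mathlib.Tactic.Ring
import Mathlib.Tactic.Positivity
import HarnessLib

/-!
# The Hogervorst–Rychkov `z`-series recursion for 3D conformal blocks: non-negative coefficients

Hogervorst–Rychkov, Phys. Rev. D 87 (2013) 106004, §3 ("Expansion coefficients from the Casimir
equation"): for four identical external scalars the conformal block of a primary `(Δ, ℓ)` is
`G_{Δ,ℓ} = Σ_{n ≥ 0} Σ_j A_{n,j} 𝒫_{Δ+n,j}(s, ξ)`, `𝒫_{E,j} = s^E j!/(2ν)_j C_j^ν(ξ)`, `s = |z|`,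
`ξ = cos θ`, and the quadratic Casimir equation is equivalent to the recursion (their eq. (3.9);
Dolan–Osborn 2004, eq. (3.12))

  `(C_{Δ+n,j} - C_{Δ,ℓ}) A_{n,j} = γ⁺_{Δ+n-1,j-1} A_{n-1,j-1} + γ⁻_{Δ+n-1,j+1} A_{n-1,j+1}`,
  `A_{0,j} = δ_{jℓ}`,  `γ⁺_{E,j} = (E+j)²(j+2ν)/(2(j+ν))`,  `γ⁻_{E,j} = (E-j-2ν)² j/(2(j+ν))`

(their eq. (3.8)), with the printed conclusion "So the coefficients generated by the recursion are
manifestly positive". This file transcribes the recursion at `d = 3` (`ν = 1/2`) as a definition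
`hrCoeff Δ ℓ n j` and PROVES, for `Δ` strictly above the 3D unitarity bound:

* `hrCoeff_support` — `A_{n,j} ≠ 0` only on the descendant range `|j - ℓ| ≤ n`,
  `j ≡ ℓ + n (mod 2)` (Hogervorst–Rychkov eq. (3.5));
* `hrCoeff_nonneg` — `A_{n,j} ≥ 0` for all `n, j` (uses `casimirPivot3D_pos`: the pivots are
  positive on the range; off the range both parent coefficients vanish);
* `hrCoeff_succ_rec` — the recursion in the printed (multiplied-out) form;
* `hrCoeff_one_succ` — the level-one value `A_{1,ℓ+1} = (Δ+ℓ)(ℓ+2ν)/(4(ℓ+ν))` of their eq. (3.10),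
  at `ν = 1/2`, as a transcription check;
* `hrLevelSum_nonneg` — the diagonal (`ξ = 1`) level sums `a_n = Σ_j A_{n,j} ≥ 0`, the input of the
  ratio lemma for diagonal point functionals (pub-ising3d REFEREE F25).

What is NOT here: that these numbers are the expansion coefficients of the Dolan–Osborn block
(the action of the Casimir operator on the `𝒫_{E,j}`, Hogervorst–Rychkov eqs. (3.6)–(3.8), is a
computation with Gegenbauer polynomials not formalised here), convergence of the series, and the
`ρ`-series of their §4. The definition divides by the pivot; where the pivot vanishes (never on the
range above the bound, `casimirPivot3D_pos`) Lean's `x / 0 = 0` convention applies and nothing is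
claimed. [cite: HogervorstRychkov2013, §3 eqs. (3.5), (3.8)–(3.10)]
-/

namespace Literature.MathematicalPhysics.QuantumFieldTheory.ConformalBootstrap3D

open Finset

/-- `γ⁺_{E,j} = (E+j)²(j+2ν)/(2(j+ν))` at `ν = 1/2`: `(E+j)²(j+1)/(2j+1)`
(Hogervorst–Rychkov 2013, eq. (3.8)). [cite: HogervorstRychkov2013, §3 eq. (3.8)] -/
noncomputable def hrGammaPlus (E : ℝ) (j : ℕ) : ℝ :=
  (E + (j : ℝ)) ^ 2 * ((j : ℝ) + 1) / (2 * (j : ℝ) + 1)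

/-- `γ⁻_{E,j} = (E-j-2ν)² j/(2(j+ν))` at `ν = 1/2`: `(E-j-1)² j/(2j+1)`
(Hogervorst–Rychkov 2013, eq. (3.8)); note `γ⁻_{E,0} = 0`. [cite: HogervorstRychkov2013, §3 eq. (3.8)] -/
noncomputable def hrGammaMinus (E : ℝ) (j : ℕ) : ℝ :=
  (E - (j : ℝ) - 1) ^ 2 * (j : ℝ) / (2 * (j : ℝ) + 1)

/-- `γ⁺ ≥ 0` (a square times `(j+1)/(2j+1)`). [cite: HogervorstRychkov2013, §3 eq. (3.8)] -/
theorem hrGammaPlus_nonneg (E : ℝ) (j : ℕ) : 0 ≤ hrGammaPlus E j := by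
  unfold hrGammaPlus
  positivity

/-- `γ⁻ ≥ 0` (a square times `j/(2j+1)`). [cite: HogervorstRychkov2013, §3 eq. (3.8)] -/
theorem hrGammaMinus_nonneg (E : ℝ) (j : ℕ) : 0 ≤ hrGammaMinus E j := by
  unfold hrGammaMinus
  positivity

/-- `γ⁻_{E,0} = 0` ("the coefficients which 'do not exist' … come out automatically zero. This
follows from the fact that `γ⁻_{E,0} = 0`"). [cite: HogervorstRychkov2013, §3 after eq. (3.10)] -/
@[simp] theorem hrGammaMinus_zero (E : ℝ) : hrGammaMinus E 0 = 0 := by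
  simp [hrGammaMinus]

/-- **The `z`-series coefficients `A_{n,j}(Δ, ℓ)` at `d = 3`**, defined by the Hogervorst–Rychkov
recursion: `A_{0,j} = δ_{jℓ}` and, for `n ≥ 0`,
`A_{n+1,j} = (γ⁺_{Δ+n,j-1} A_{n,j-1} + γ⁻_{Δ+n,j+1} A_{n,j+1}) / (C_{Δ+n+1,j} - C_{Δ,ℓ})`
(the `γ⁺` term absent for `j = 0`). The pivot is `casimirPivot3D Δ ℓ (n+1) j`; it is non-zero on
the descendant range above the unitarity bound (`casimirPivot3D_pos`), and off the range the
numerator vanishes (`hrCoeff_support`), so the division convention `x/0 = 0` never matters there.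
(Hogervorst–Rychkov 2013, eq. (3.9) with initial condition (3.9b); Dolan–Osborn 2004, eq. (3.12).)
[cite: HogervorstRychkov2013, §3 eq. (3.9)] -/
noncomputable def hrCoeff (Δ : ℝ) (ℓ : ℕ) : ℕ → ℕ → ℝ
  | 0, j => if j = ℓ then 1 else 0
  | n + 1, j =>
      ((if j = 0 then 0 else hrGammaPlus (Δ + n) (j - 1) * hrCoeff Δ ℓ n (j - 1)) +
          hrGammaMinus (Δ + n) (j + 1) * hrCoeff Δ ℓ n (j + 1)) /
        casimirPivot3D Δ ℓ (n + 1) j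

/-- Initial condition: `A_{0,ℓ} = 1`. [cite: HogervorstRychkov2013, §3 eq. (3.9)] -/
@[simp] theorem hrCoeff_zero_self (Δ : ℝ) (ℓ : ℕ) : hrCoeff Δ ℓ 0 ℓ = 1 := by
  simp [hrCoeff]

/-- Initial condition: `A_{0,j} = 0` for `j ≠ ℓ`. [cite: HogervorstRychkov2013, §3 eq. (3.9)] -/
theorem hrCoeff_zero_of_ne (Δ : ℝ) {ℓ j : ℕ} (h : j ≠ ℓ) : hrCoeff Δ ℓ 0 j = 0 := by
  simp [hrCoeff, h]

/-- The recursion step, unfolded. [cite: HogervorstRychkov2013, §3 eq. (3.9)] -/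
theorem hrCoeff_succ (Δ : ℝ) (ℓ n j : ℕ) :
    hrCoeff Δ ℓ (n + 1) j =
      ((if j = 0 then 0 else hrGammaPlus (Δ + n) (j - 1) * hrCoeff Δ ℓ n (j - 1)) +
          hrGammaMinus (Δ + n) (j + 1) * hrCoeff Δ ℓ n (j + 1)) /
        casimirPivot3D Δ ℓ (n + 1) j := by
  rfl

/-- The Hogervorst–Rychkov descendant range at level `n` for a spin-`ℓ` primary:
`|j - ℓ| ≤ n` and `j ≡ ℓ + n (mod 2)`, i.e. `j ∈ {ℓ+n, ℓ+n-2, …, max(ℓ-n, (ℓ+n) mod 2)}`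
(their eq. (3.5)). [cite: HogervorstRychkov2013, §3 eq. (3.5)] -/
def InDescendantRange (ℓ n j : ℕ) : Prop :=
  ℓ ≤ j + n ∧ j ≤ ℓ + n ∧ (j + ℓ + n) % 2 = 0

/-- Membership in the descendant range is decidable (three `ℕ` (in)equalities). [folklore] -/
instance (ℓ n j : ℕ) : Decidable (InDescendantRange ℓ n j) := by
  unfold InDescendantRange; infer_instance

/-- **Support.** A non-zero coefficient lies on the descendant range (induction on the level: a
non-zero `A_{n+1,j}` has a non-zero parent `A_{n,j∓1}`). Holds for every `Δ`.
[cite: HogervorstRychkov2013, §3 eq. (3.5)] -/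
theorem hrCoeff_support (Δ : ℝ) (ℓ : ℕ) :
    ∀ n j : ℕ, hrCoeff Δ ℓ n j ≠ 0 → InDescendantRange ℓ n j := by
  intro n
  induction n with
  | zero =>
    intro j hj
    by_cases h : j = ℓ
    · subst h
      exact ⟨by omega, by omega, by omega⟩
    · exact absurd (hrCoeff_zero_of_ne Δ h) hj
  | succ n ih =>
    intro j hj
    rw [hrCoeff_succ] at hj
    -- the numerator is non-zero, so one of the two parent terms is non-zero
    have hnum : (if j = 0 then 0 else hrGammaPlus (Δ + n) (j - 1) * hrCoeff Δ ℓ n (j - 1)) +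
        hrGammaMinus (Δ + n) (j + 1) * hrCoeff Δ ℓ n (j + 1) ≠ 0 := by
      intro h0
      apply hj
      rw [h0, zero_div]
    by_cases hm : hrCoeff Δ ℓ n (j + 1) ≠ 0
    · obtain ⟨h1, h2, h3⟩ := ih (j + 1) hm
      exact ⟨by omega, by omega, by omega⟩
    · have hm' : hrCoeff Δ ℓ n (j + 1) = 0 := not_ne_iff.mp hm
      rw [hm', mul_zero, add_zero] at hnum
      by_cases hj0 : j = 0
      · simp [hj0] at hnum
      · rw [if_neg hj0] at hnum
        have hp : hrCoeff Δ ℓ n (j - 1) ≠ 0 := by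
          intro h0
          apply hnum
          rw [h0, mul_zero]
        obtain ⟨h1, h2, h3⟩ := ih (j - 1) hp
        exact ⟨by omega, by omega, by omega⟩

/-- Off the descendant range the coefficient vanishes. [cite: HogervorstRychkov2013, §3 eq. (3.5)] -/
theorem hrCoeff_eq_zero_of_not_inDescendantRange (Δ : ℝ) {ℓ n j : ℕ}
    (h : ¬ InDescendantRange ℓ n j) : hrCoeff Δ ℓ n j = 0 := by
  by_contra hne
  exact h (hrCoeff_support Δ ℓ n j hne)

/-- **Non-negativity ("manifestly positive").** Strictly above the 3D unitarity bound every
coefficient `A_{n,j}` generated by the recursion is `≥ 0`: the `γ^±` are non-negative and the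
pivots are positive on the descendant range (`casimirPivot3D_pos`), while off the range the
coefficient is `0`. [cite: HogervorstRychkov2013, §3 after eq. (3.9)] -/
theorem hrCoeff_nonneg {Δ : ℝ} {ℓ : ℕ} (hΔ : unitarityBound3D ℓ < Δ) :
    ∀ n j : ℕ, 0 ≤ hrCoeff Δ ℓ n j := by
  intro n
  induction n with
  | zero =>
    intro j
    by_cases h : j = ℓ
    · subst h; simp
    · rw [hrCoeff_zero_of_ne Δ h]
  | succ n ih =>
    intro j
    by_cases hr : InDescendantRange ℓ (n + 1) j
    · obtain ⟨h1, h2, h3⟩ := hr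
      rw [hrCoeff_succ]
      apply div_nonneg
      · apply add_nonneg
        · split_ifs
          · exact le_rfl
          · exact mul_nonneg (hrGammaPlus_nonneg _ _) (ih _)
        · exact mul_nonneg (hrGammaMinus_nonneg _ _) (ih _)
      · exact (casimirPivot3D_pos hΔ (by omega) h1 h2 h3).le
    · rw [hrCoeff_eq_zero_of_not_inDescendantRange Δ hr]

/-- The recursion in the printed, multiplied-out form, valid wherever the pivot is non-zero — in
particular everywhere on the descendant range above the unitarity bound:
`(C_{Δ+n+1,j} - C_{Δ,ℓ}) A_{n+1,j} = γ⁺_{Δ+n,j-1} A_{n,j-1} + γ⁻_{Δ+n,j+1} A_{n,j+1}`.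
[cite: HogervorstRychkov2013, §3 eq. (3.9)] -/
theorem hrCoeff_succ_rec {Δ : ℝ} {ℓ n j : ℕ} (hp : casimirPivot3D Δ ℓ (n + 1) j ≠ 0) :
    casimirPivot3D Δ ℓ (n + 1) j * hrCoeff Δ ℓ (n + 1) j =
      (if j = 0 then 0 else hrGammaPlus (Δ + n) (j - 1) * hrCoeff Δ ℓ n (j - 1)) +
        hrGammaMinus (Δ + n) (j + 1) * hrCoeff Δ ℓ n (j + 1) := by
  rw [hrCoeff_succ, mul_div_cancel₀ _ hp]

/-- **Transcription check at level one**: `A_{1,ℓ+1} = (Δ+ℓ)(ℓ+2ν)/(4(ℓ+ν))` at `ν = 1/2`, i.e.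
`(Δ+ℓ)(ℓ+1)/(2(2ℓ+1))`, for `Δ` above the unitarity bound (so that `Δ + ℓ > 0`).
(Hogervorst–Rychkov 2013, eq. (3.10), first line.) [cite: HogervorstRychkov2013, §3 eq. (3.10)] -/
theorem hrCoeff_one_succ {Δ : ℝ} {ℓ : ℕ} (hΔ : unitarityBound3D ℓ < Δ) :
    hrCoeff Δ ℓ 1 (ℓ + 1) = (Δ + ℓ) * ((ℓ : ℝ) + 1) / (2 * (2 * (ℓ : ℝ) + 1)) := by
  have hhalf : 1 / 2 < Δ := one_half_lt_of_unitarityBound3D_lt hΔ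
  have hΔℓ : 0 < Δ + (ℓ : ℝ) := by positivity
  have hpiv : casimirPivot3D Δ ℓ 1 (ℓ + 1) = 2 * (Δ + (ℓ : ℝ)) := by
    unfold casimirPivot3D; push_cast; ring
  have hne : ℓ + 1 + 1 ≠ ℓ := by omega
  change hrCoeff Δ ℓ (0 + 1) (ℓ + 1) = _
  rw [hrCoeff_succ]
  simp only [Nat.add_sub_cancel, hrCoeff_zero_self, hrCoeff_zero_of_ne Δ hne, mul_zero, add_zero,
    mul_one, Nat.cast_zero, add_zero]
  rw [if_neg (by omega), hpiv]
  unfold hrGammaPlus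
  have h2 : (2 : ℝ) * (ℓ : ℝ) + 1 ≠ 0 := by positivity
  field_simp

/-- The diagonal level sum `a_n(Δ, ℓ) = Σ_{j ≤ ℓ+n} A_{n,j}` — the coefficient of `x^{Δ+n}` in
`g_{Δ,ℓ}(x, x)` once the `A_{n,j}` are identified with the block's coefficients (`C_j^ν(1)`
normalisation: `𝒫_{E,j}(s, 1) = s^E`). [cite: HogervorstRychkov2013, §3 eq. (3.4)] -/
noncomputable def hrLevelSum (Δ : ℝ) (ℓ n : ℕ) : ℝ :=
  ∑ j ∈ Finset.range (ℓ + n + 1), hrCoeff Δ ℓ n j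

/-- The level sums are non-negative above the unitarity bound (termwise, `hrCoeff_nonneg`) — the
sign input of the ratio lemma for diagonal point functionals. [cite: HogervorstRychkov2013, §3 after eq. (3.9)] -/
theorem hrLevelSum_nonneg {Δ : ℝ} {ℓ : ℕ} (hΔ : unitarityBound3D ℓ < Δ) (n : ℕ) :
    0 ≤ hrLevelSum Δ ℓ n :=
  Finset.sum_nonneg fun j _ => hrCoeff_nonneg hΔ n j

/-- The level-zero sum is `1` (normalisation `A_{0,ℓ} = 1`). [cite: HogervorstRychkov2013, §3 eq. (3.4)] -/
theorem hrLevelSum_zero (Δ : ℝ) (ℓ : ℕ) : hrLevelSum Δ ℓ 0 = 1 := by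
  unfold hrLevelSum
  rw [Finset.sum_eq_single ℓ]
  · simp
  · intro j _ hj
    exact hrCoeff_zero_of_ne Δ hj
  · intro h
    exact absurd (Finset.mem_range.mpr (by omega)) h

/-- Coefficients beyond `j = ℓ + n` vanish, so `hrLevelSum` is the full sum over `j`.
[cite: HogervorstRychkov2013, §3 eq. (3.5)] -/
theorem hrCoeff_eq_zero_of_lt (Δ : ℝ) {ℓ n j : ℕ} (h : ℓ + n < j) : hrCoeff Δ ℓ n j = 0 :=
  hrCoeff_eq_zero_of_not_inDescendantRange Δ (fun hr => by obtain ⟨_, h2, _⟩ := hr; omega)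

end Literature.MathematicalPhysics.QuantumFieldTheory.ConformalBootstrap3D
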